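import Literature.AlgebraicGeometry.HodgeTheory.HodgeSheafComap
import HarnessLib

/-!
# Along an isomorphism of `S`-schemes, `Ωʲ_{X₁/S} ≅ e_* Ωʲ_{X₀/S}`

Layer `Literature/AlgebraicGeometry/HodgeTheory`; companion of `HodgeSheafComap.lean` (the pull-back
`g^♯ : Ωʲ_{X₁/S} ⟶ g_* Ωʲ_{X₀/S}` for any morphism `g` of `S`-schemes) and of `CotangentSheafComap.lean`
(`j = 1`, including the isomorphism case). For an ISOMORPHISM `e : X₀ ≅ X₁` of `S`-schemes this file
PROVES (no named facts, no hypothesis structures):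

* the round trips `resF_backHom_appF_appF` (functions: `(e⁻¹)♯(e♯ a)` restricted back along
  `U = e⁻¹⁻¹(e⁻¹U)` is `a`), `formsOne_map_backHom_comapOneApp_comapOneApp` (`1`-forms, from
  `comap_comp_pushforward_comap_inv`), `restrWedge_comapWedge_comapWedge` (presheaf-level `j`-forms,
  by induction on pure wedges);
* the key identity `hodgeSheaf.comap_comp_pushforward_comap_inv :
  e^♯ ≫ e_*((e⁻¹)^♯) ≫ (e_* e⁻¹_* Ωʲ ≅ Ωʲ) = 𝟙` (checked on presheaf-level forms,
  `hodgeSheaf.hom_ext_toHodgeSheaf`);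
* **`hodgeSheaf.isIso_comap_hom : IsIso (hodgeSheaf.comap e.hom j)`** (the key identity for `e` and
  for `e⁻¹` make `e_*((e⁻¹)^♯)` a split mono and a split epi) and the isomorphism
  **`hodgeSheaf.comapIso e j : Ωʲ_{X₁/S} ≅ e_* Ωʲ_{X₀/S}`**, `hom = e^♯`, inverse explicit
  (`comapIso_inv`).

Motivation (venture HSemireg, bridge (B1), residual gap (T)): `Modules/PushforwardIsoCohomology`
(cohomology of `e_*`) + this file (the SOURCE `Ωʲ` of Bloch's pairing map is compatible with `e_*`)
leave, for the transport of `IsBlochSemiregular` along an isomorphism of the ambient scheme, only the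
TARGET `𝓐lt_r(𝓘; Ωⁿ|_Z)` and the naturality of the pairing.

References: R. Hartshorne, *Algebraic Geometry* (1977), II Ex. 5.16 (e) (`f^*` commutes with
exterior powers) with II Prop. 8.11 (pull-back of differentials); typed weaker-or-equal: only the
isomorphism case is asserted to be an isomorphism, in adjoint (`e_*`) form. [Hartshorne1977]
-/

noncomputable section

open CategoryTheory CategoryTheory.Limits AlgebraicGeometry Opposite TopologicalSpace

universe u

namespace Literature.AlgebraicGeometry.HodgeTheory

open Literature.AlgebraicGeometry.Modules Literature.AlgebraicGeometry.Motives

/-! ### Along an isomorphism of `S`-schemes, `Ωʲ_{X₁/S} ≅ e_* Ωʲ_{X₀/S}` -/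

section HodgeIso

variable {S : Type u} [CommRing S] {X₀ X₁ : Over (Spec (CommRingCat.of S))} (e : X₀ ≅ X₁) (j : ℕ)

/-- For an isomorphism `e` of `S`-schemes, `e⁻¹ ≫ e = 𝟙` on underlying schemes. [folklore] -/
private theorem inv_left_comp_hom_left' : e.inv.left ≫ e.hom.left = 𝟙 X₁.left := by
  rw [← Over.comp_left, e.inv_hom_id, Over.id_left]

/-- `U = e⁻¹⁻¹(e⁻¹(U))` for an isomorphism `e`, as a morphism of opens (an `eqToHom`). [folklore] -/
def backHom (U : X₁.left.Opens) : U ⟶ e.inv.left ⁻¹ᵁ (e.hom.left ⁻¹ᵁ U) :=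
  eqToHom (by
    change (𝟙 X₁.left) ⁻¹ᵁ U = (e.inv.left ≫ e.hom.left) ⁻¹ᵁ U
    rw [inv_left_comp_hom_left'])

/-- The round trip on functions: `(e⁻¹)♯(e♯ a)`, restricted back along `U = e⁻¹⁻¹(e⁻¹U)`, is `a`.
[cite: Hartshorne1977, II §1 p. 65 (direct image: (f_*ℱ)(V) = ℱ(f⁻¹(V)))] -/
theorem resF_backHom_appF_appF (U : X₁.left.Opens)
    (a : (X₁.left.presheaf ⋙ forget₂ CommRingCat RingCat).obj (op U)) :
    resF (backHom e U) (appF e.inv (e.hom.left ⁻¹ᵁ U) (appF e.hom U a)) = a := by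
  change ((e.hom.left.app U ≫ e.inv.left.app (e.hom.left ⁻¹ᵁ U)) ≫
    X₁.left.presheaf.map (eqToHom _).op) a = a
  rw [← Scheme.Hom.comp_app, Scheme.Hom.congr_app (inv_left_comp_hom_left' e) U, Scheme.Hom.id_app]
  exact presheaf_map_eqToHom_op_map_eqToHom_op_apply _ _ a

/-- The round trip on `1`-forms: `(e⁻¹)^♯(e^♯ θ)`, restricted back, is `θ` (elementwise form of
`comap_comp_pushforward_comap_inv`).
[cite: Hartshorne1977, II Prop. 8.11 (the first map f^*Ω_{Y/Z} → Ω_{X/Z}, adjoint form; reading: functoriality along e⁻¹ ≫ e = 𝟙)] -/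
theorem formsOne_map_backHom_comapOneApp_comapOneApp (U : X₁.left.Opens)
    (θ : (formsOne X₁).obj (op U)) :
    ((formsOne X₁).map (backHom e U).op
      (comapOneApp e.inv (e.hom.left ⁻¹ᵁ U) (comapOneApp e.hom U θ)) : (formsOne X₁).obj (op U)) =
      θ := by
  have h := congrArg (fun φ : cotangentSheaf X₁ ⟶ cotangentSheaf X₁ =>
    φ.app U (θ : Γ(cotangentSheaf X₁, U))) (comap_comp_pushforward_comap_inv e)
  simp only [Scheme.Modules.Hom.comp_app, Scheme.Modules.Hom.id_app] at h
  exact h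

/-- The round trip on presheaf-level `j`-forms: `⋀ʲ(e⁻¹)^♯ (⋀ʲ e^♯ ω)`, restricted back, is `ω`.
[cite: Hartshorne1977, II Ex. 5.16 (e) with II Prop. 8.11 (pull-back of exterior powers of differentials, adjoint form)] -/
theorem restrWedge_comapWedge_comapWedge (U : X₁.left.Opens)
    (ω : ((formsOne X₁).obj (op U)).exteriorPower j) :
    restrWedge j (backHom e U) (comapWedge e.inv j (e.hom.left ⁻¹ᵁ U) (comapWedge e.hom j U ω)) = ω := by
  induction ω using formsPresheaf_induction j with
  | mk m =>
    rw [comapWedge_mk, comapWedge_mk, restrWedge_mk]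
    congr 1
    funext k
    exact formsOne_map_backHom_comapOneApp_comapOneApp e U (m k)
  | zero => simp only [map_zero]
  | add x y hx hy => simp only [map_add, hx, hy]
  | smul a x hx =>
    rw [comapWedge_smul, comapWedge_smul, restrWedge_smul, hx, resF_backHom_appF_appF]

/-- The key identity: `e^♯ ≫ e_*((e⁻¹)^♯) ≫ (e_* e⁻¹_* Ωʲ ≅ Ωʲ) = 𝟙` on `Ωʲ_{X₁/S}` — checked on
presheaf-level forms via `restrWedge_comapWedge_comapWedge`.
[cite: Hartshorne1977, II Ex. 5.16 (e) with II Prop. 8.11 (pull-back of exterior powers of differentials, adjoint form; reading: functoriality along e⁻¹ ≫ e = 𝟙)] -/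
theorem hodgeSheaf.comap_comp_pushforward_comap_inv :
    hodgeSheaf.comap e.hom j ≫
      (Scheme.Modules.pushforward e.hom.left).map (hodgeSheaf.comap e.inv j) ≫
        (pushforwardInvHomIso e (hodgeSheaf X₁ j)).hom = 𝟙 _ := by
  refine hodgeSheaf.hom_ext_toHodgeSheaf j _ _ fun U ω => ?_
  rw [Scheme.Modules.Hom.comp_app, Scheme.Modules.Hom.comp_app, Scheme.Modules.Hom.id_app,
    pushforwardInvHomIso_hom_app]
  change (hodgeSheaf X₁ j).val.map (backHom e U).op
      ((hodgeSheaf.comap e.inv j).app (e.hom.left ⁻¹ᵁ U)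
        ((hodgeSheaf.comap e.hom j).app U ((toHodgeSheaf X₁ j).app (op U) ω))) =
    (toHodgeSheaf X₁ j).app (op U) ω
  rw [hodgeSheaf.comap_app_toHodgeSheaf, hodgeSheaf.comap_app_toHodgeSheaf]
  have key := restrWedge_comapWedge_comapWedge e j U ω
  rw [restrWedge_apply] at key
  refine Eq.trans ?_ (congrArg (fun y => (toHodgeSheaf X₁ j).app (op U) y) key)
  exact (PresheafOfModules.naturality_apply (toHodgeSheaf X₁ j) (backHom e U).op _).symm

/-- **Along an isomorphism `e : X₀ ≅ X₁` of `S`-schemes the pull-back of `j`-forms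
`e^♯ : Ωʲ_{X₁/S} ⟶ e_* Ωʲ_{X₀/S}` is an isomorphism of `𝒪_{X₁}`-modules** (split mono + split epi,
from the key identity for `e` and for `e⁻¹`).
[cite: Hartshorne1977, II Ex. 5.16 (e) with II Prop. 8.11 (pull-back of exterior powers of differentials; reading: an isomorphism for an isomorphism)] -/
instance hodgeSheaf.isIso_comap_hom : IsIso (hodgeSheaf.comap e.hom j) := by
  let A := hodgeSheaf.comap e.hom j
  let B := (Scheme.Modules.pushforward e.hom.left).map (hodgeSheaf.comap e.inv j)
  let c := pushforwardInvHomIso e (hodgeSheaf X₁ j)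
  have h1 : A ≫ B ≫ c.hom = 𝟙 _ := hodgeSheaf.comap_comp_pushforward_comap_inv e j
  have h1' := hodgeSheaf.comap_comp_pushforward_comap_inv e.symm j
  have h2 : B ≫ (Scheme.Modules.pushforward e.hom.left).map
      ((Scheme.Modules.pushforward e.inv.left).map (hodgeSheaf.comap e.hom j) ≫
        (pushforwardInvHomIso e.symm (hodgeSheaf X₀ j)).hom) = 𝟙 _ := by
    rw [← CategoryTheory.Functor.map_comp]
    change (Scheme.Modules.pushforward e.hom.left).map (hodgeSheaf.comap e.symm.hom j ≫
      (Scheme.Modules.pushforward e.symm.hom.left).map (hodgeSheaf.comap e.symm.inv j) ≫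
        (pushforwardInvHomIso e.symm (hodgeSheaf X₀ j)).hom) = _
    rw [h1', CategoryTheory.Functor.map_id]
  have hAB : A ≫ B = c.inv := by
    rw [← Iso.comp_hom_eq_id, Category.assoc]
    exact h1
  haveI : IsSplitMono B := IsSplitMono.mk' ⟨_, h2⟩
  haveI : IsSplitEpi B := IsSplitEpi.mk' ⟨c.hom ≫ A, by rw [Category.assoc, hAB, c.hom_inv_id]⟩
  haveI : IsIso B := isIso_of_mono_of_isSplitEpi B
  have hA : A = c.inv ≫ inv B := by
    rw [← hAB, Category.assoc, IsIso.hom_inv_id, Category.comp_id]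
  change IsIso A
  rw [hA]
  infer_instance

/-- **`Ωʲ_{X₁/S} ≅ e_* Ωʲ_{X₀/S}`** for an isomorphism `e : X₀ ≅ X₁` of `S`-schemes, with
`hom = e^♯` (on presheaf-level forms: `θ₁ ∧ ⋯ ∧ θⱼ ↦ e^♯θ₁ ∧ ⋯ ∧ e^♯θⱼ`).
[cite: Hartshorne1977, II Ex. 5.16 (e) with II Prop. 8.11 (pull-back of exterior powers of differentials; reading: an isomorphism for an isomorphism)] -/
def hodgeSheaf.comapIso :
    hodgeSheaf X₁ j ≅ (Scheme.Modules.pushforward e.hom.left).obj (hodgeSheaf X₀ j) :=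
  asIso (hodgeSheaf.comap e.hom j)

/-- `(hodgeSheaf.comapIso e j).hom = hodgeSheaf.comap e.hom j`.
[cite: Hartshorne1977, II Ex. 5.16 (e) with II Prop. 8.11 (pull-back of exterior powers of differentials, adjoint form)] -/
@[simp]
theorem hodgeSheaf.comapIso_hom : (hodgeSheaf.comapIso e j).hom = hodgeSheaf.comap e.hom j := rfl

/-- The inverse of `hodgeSheaf.comapIso e j` is `e_*((e⁻¹)^♯)` followed by `e_* e⁻¹_* Ωʲ ≅ Ωʲ`.
[cite: Hartshorne1977, II Ex. 5.16 (e) with II Prop. 8.11 (pull-back of exterior powers of differentials; reading: its inverse for an isomorphism)] -/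
theorem hodgeSheaf.comapIso_inv :
    (hodgeSheaf.comapIso e j).inv =
      (Scheme.Modules.pushforward e.hom.left).map (hodgeSheaf.comap e.inv j) ≫
        (pushforwardInvHomIso e (hodgeSheaf X₁ j)).hom :=
  IsIso.inv_eq_of_hom_inv_id (hodgeSheaf.comap_comp_pushforward_comap_inv e j)

end HodgeIso

end Literature.AlgebraicGeometry.HodgeTheory

end
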